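import Literature.Probability.RandomPlanarGeometry.SLESixLocalityFreeChain
import Literature.Probability.RandomPlanarGeometry.NestedJordanFreeOrder
import HarnessLib

/-!
# Locality of chordal SLE₆, restriction form: the full fact from its bounded clause

Topic `Probability/RandomPlanarGeometry`; theorems only. We PROVE

* `IsSLELaw.locality_six_of_bounded : IsSLELaw.locality_six_bounded → IsSLELaw.locality_six`:

the restriction form of the locality of chordal SLE₆ (G. F. Lawler, O. Schramm, W. Werner,
*Values of Brownian intersection exponents I*, Acta Math. **187** (2001), Thm. 2.2 and Cor. 2.4;
the tree's named fact `IsSLELaw.locality_six`, `SLESixLocality.lean`, stated for ALL nested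
Dobrushin domains `D' ⊆ D` with common marked points `a, b`) follows from its **bounded clause**
`IsSLELaw.locality_six_bounded` (`SLESixHullLocalityFact.lean`: the same identity for hull
subdomains, i.e. under the printed hypothesis `a, b ∉ \bar I` of Cor. 2.4), together with the
target independence of SLE₆ (LSW Cor. 2.3, proved in the tree). By
`IsSLELaw.locality_six_of_nondegenerate` only the case `a ∉ F := closure (D ∖ D')`, `D' ≠ D`
matters; if moreover `b ∉ F` the pair is a hull pair and the bounded clause applies verbatim.
The content is the **buried target** case `b ∈ F` (the removed part accumulates at the target,
possibly from both sides, so that no re-targeting near `b` produces a hull pair):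

* `IsSLELaw.locality_clause_of_pt_one_mem_of_rebased` — both loops based at `a`
  (`mark 0 = 0`). Let `τ = D.mark 1` (`b = ∂D τ`) and `σ = sup` of the free parameters
  `s ∈ (0, τ)` (`∂D s ∉ F`); then `∂D[σ, τ] ⊆ F` and there are free `s_n → σ`. For each `n` the
  chain of `SLESixLocalityFreeChain.lean` through the free target `t_n = ∂D s_n = ∂D' u_n`
  shows that the two SLE₆ laws agree once stopped on
  `S_n = F ∪ ∂D[s_n, τ] ∪ ∂D'[u_n ∧ τ', u_n ∨ τ']`. These closed sets contain `F` and shrink to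
  `F` (`measure_preimage_stopAt_eq_of_shrinking`): limits of points of `∂D[s_n, τ]` lie on
  `∂D[σ, τ] ⊆ F`, and limits of points of the `∂D'`-arcs lie on the `∂D'`-arc from
  `e = ∂D σ` to `b` not containing `a`, which is buried as well by the order lemma
  `MarkedDomain.boundary_mem_closure_diff_of_mem_uIcc` (Newman's cross-cut theorem);
* `MarkedDomain.exists_rebase` — re-basing a Dobrushin domain at `a` (an SLE law depends on the
  domain only through its carrier and marked points, `IsSLELaw.of_carrier_eq`);
* `IsSLELaw.locality_six_of_bounded` — the assembly.

## References

* G. F. Lawler, O. Schramm, W. Werner, Acta Math. 187 (2001), Thm. 2.2, Cor. 2.3, Cor. 2.4.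
  [LawlerSchrammWerner2001]
* M. H. A. Newman, *Elements of the topology of plane sets of points* (1939), Ch. V §11.
  [Newman1939]
-/

noncomputable section

open Set Filter Topology MeasureTheory Metric
open scoped NNReal

namespace Literature.Probability.RandomPlanarGeometry

open Literature.Probability.Process

/-! ### Re-basing a Dobrushin domain at its first marked point -/

namespace MarkedDomain

/-- **Re-basing the boundary loop at `a`**: every Dobrushin domain `(D; a, b)` has the same
carrier and marked points as one whose loop is based at `a` (`mark 0 = 0`; loop
`t ↦ ∂D (t + mark 0)`, marks `0`, `mark 1 − mark 0`). [folklore] -/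
theorem exists_rebase (D : DobrushinDomain) :
    ∃ D₀ : DobrushinDomain, D₀.carrier = D.carrier ∧ D₀.mark 0 = 0 ∧ D₀.pt 0 = D.pt 0 ∧
      D₀.pt 1 = D.pt 1 := by
  have h0 := (D.mark_mem 0).1
  have h1 := (D.mark_mem 1).2
  have h01 : D.mark 0 < D.mark 1 := D.strictMono_mark (show (0 : Fin 2) < 1 by decide)
  let D₀ : DobrushinDomain :=
    { carrier := D.carrier
      boundary := fun t ↦ D.boundary (t + D.mark 0)
      isOpen := D.isOpen
      isBounded := D.isBounded
      isConnected := D.isConnected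
      continuous_boundary := D.continuous_boundary.comp (continuous_id.add continuous_const)
      periodic_boundary := D.periodic_boundary.add_const _
      injOn_boundary := fun s hs t ht hst ↦
        add_right_cancel (D.injOn_boundary_Ico (D.mark 0)
          (show s + D.mark 0 ∈ Ico (D.mark 0) (D.mark 0 + 1) from
            ⟨by linarith [hs.1], by linarith [hs.2]⟩)
          (show t + D.mark 0 ∈ Ico (D.mark 0) (D.mark 0 + 1) from
            ⟨by linarith [ht.1], by linarith [ht.2]⟩)
          (show D.boundary (s + D.mark 0) = D.boundary (t + D.mark 0) from hst))
      range_boundary := by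
        rw [show (fun t ↦ D.boundary (t + D.mark 0)) = D.boundary ∘ fun t ↦ t + D.mark 0 from rfl,
          (add_right_surjective _).range_comp]
        exact D.range_boundary
      mark := ![0, D.mark 1 - D.mark 0]
      strictMono_mark := Fin.strictMono_iff_lt_succ.2 fun k ↦ by
        fin_cases k
        show (0 : ℝ) < D.mark 1 - D.mark 0
        linarith
      mark_mem := fun k ↦ by
        fin_cases k
        · show (0 : ℝ) ∈ Ico (0 : ℝ) 1; exact ⟨le_rfl, one_pos⟩
        · show D.mark 1 - D.mark 0 ∈ Ico (0 : ℝ) 1; exact ⟨by linarith, by linarith⟩ }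
  refine ⟨D₀, rfl, rfl, ?_, ?_⟩
  · show D.boundary (0 + D.mark 0) = D.boundary (D.mark 0)
    rw [zero_add]
  · show D.boundary (D.mark 1 - D.mark 0 + D.mark 0) = D.boundary (D.mark 1)
    rw [sub_add_cancel]

end MarkedDomain

/-! ### Free boundary points -/

/-- **A free boundary point of `D` is a boundary point of `D'`**: a point of `∂D` off
`closure (D ∖ D')` (`D' ⊆ D`) lies on `∂D'`. [folklore] -/
theorem JordanDomain.mem_frontier_of_notMem_closure_diff {D D' : JordanDomain}
    (hsub : D'.carrier ⊆ D.carrier) {t : ℂ} (ht : t ∈ frontier D.carrier)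
    (htF : t ∉ closure (D.carrier \ D'.carrier)) : t ∈ frontier D'.carrier := by
  have hcl : t ∈ closure D'.carrier := by
    have h1 : closure D.carrier ⊆ closure D'.carrier ∪ closure (D.carrier \ D'.carrier) := by
      rw [← closure_union]
      exact closure_mono fun z hz ↦ by
        by_cases h : z ∈ D'.carrier
        · exact Or.inl h
        · exact Or.inr ⟨hz, h⟩
    rcases h1 (frontier_subset_closure ht) with h | h
    · exact h
    · exact absurd h htF
  refine ⟨hcl, ?_⟩
  rw [D'.isOpen.interior_eq]
  intro htD'
  have h2 := ht.2
  rw [D.isOpen.interior_eq] at h2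
  exact h2 (hsub htD')

/-! ### The buried-target clause for loops based at `a` -/

/-- **The locality clause when the removed part reaches the target, loops based at `a`.** For
chordal SLE₆ laws `μ`, `μ'` of Dobrushin domains `D' ⊆ D` with the same marked points
`a = pt 0 ∉ F`, `b = pt 1 ∈ F` (`F = closure (D ∖ D')`) and both loops based at `a`
(`mark 0 = 0`), the classes stopped on `F` have the same law — given the bounded clause `hB`.
See the module docstring for the proof (free targets `t_n → e`, the chain of
`SLESixLocalityFreeChain.lean`, shrinking stopping sets, and the order lemma for the
`∂D'`-arcs). [cite: LawlerSchrammWerner2001, Thm 2.2 and Cor 2.4] -/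
theorem IsSLELaw.locality_clause_of_pt_one_mem_of_rebased (hB : IsSLELaw.locality_six_bounded)
    {D D' : DobrushinDomain} (hD : D.mark 0 = 0) (hD' : D'.mark 0 = 0)
    {μ μ' : Measure (CurveClass ℂ)} (hμ : IsSLELaw 6 D μ) (hμ' : IsSLELaw 6 D' μ')
    (hsub : D'.carrier ⊆ D.carrier) (h0 : D'.pt 0 = D.pt 0) (h1 : D'.pt 1 = D.pt 1)
    (ha : D.pt 0 ∉ closure (D.carrier \ D'.carrier))
    (hb : D.pt 1 ∈ closure (D.carrier \ D'.carrier))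
    {T : Set (CurveClass ℂ)} (hT : MeasurableSet T) :
    μ' (CurveClass.stopAt (closure (D.carrier \ D'.carrier)) ⁻¹' T) =
      μ (CurveClass.stopAt (closure (D.carrier \ D'.carrier)) ⁻¹' T) := by
  haveI : Fact isProjectiveLimit_preWienerMeasure := ⟨isProjectiveLimit_preWienerMeasure_holds⟩
  haveI := hμ.isProbabilityMeasure
  haveI := hμ'.isProbabilityMeasure
  set F : Set ℂ := closure (D.carrier \ D'.carrier) with hFdef
  have hF : IsClosed F := isClosed_closure
  set τ : ℝ := D.mark 1 with hτdef
  set τ' : ℝ := D'.mark 1 with hτ'def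
  have hτ : τ ∈ Ico (0 : ℝ) 1 := D.mark_mem 1
  have hτ' : τ' ∈ Ico (0 : ℝ) 1 := D'.mark_mem 1
  have hτ0 : 0 < τ := by
    have := D.strictMono_mark (show (0 : Fin 2) < 1 by decide)
    rwa [hD] at this
  have ha0 : D.boundary 0 ∉ F := MarkedDomain.pt_zero_of_mark_zero hD ▸ ha
  have hbτ : D.boundary τ ∈ F := hb
  have ha0' : D'.boundary 0 = D.boundary 0 := by
    rw [← MarkedDomain.pt_zero_of_mark_zero hD, ← MarkedDomain.pt_zero_of_mark_zero hD']; exact h0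
  -- the free parameters of `∂D` and their supremum `σ` below `τ`
  set Φ : Set ℝ := {s : ℝ | D.boundary s ∉ F} with hΦdef
  have hΦo : IsOpen Φ := hF.isOpen_compl.preimage D.continuous_boundary
  set Sset : Set ℝ := Φ ∩ Ioo 0 τ with hSset
  have hbdd : BddAbove Sset := ⟨τ, fun s hs ↦ hs.2.2.le⟩
  obtain ⟨ε, hε, hball⟩ := Metric.isOpen_iff.1 hΦo 0 ha0
  have hne : Sset.Nonempty := by
    refine ⟨min (ε / 2) (τ / 2), hball ?_, lt_min (by linarith) (by linarith),
      (min_le_right _ _).trans_lt (by linarith)⟩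
    rw [mem_ball, Real.dist_eq, sub_zero, abs_of_pos (lt_min (by linarith) (by linarith))]
    exact (min_le_left _ _).trans_lt (by linarith)
  set σ : ℝ := sSup Sset with hσdef
  have hσ_le : σ ≤ τ := csSup_le hne fun s hs ↦ hs.2.2.le
  have hσ_pos : 0 < σ := by
    obtain ⟨s₀, hs₀⟩ := hne
    exact hs₀.2.1.trans_le (le_csSup hbdd hs₀)
  have hburied : ∀ s ∈ Icc σ τ, D.boundary s ∈ F := by
    intro s hs
    by_contra hsF
    rcases hs.2.lt_or_eq with hlt | heq
    · rcases hs.1.lt_or_eq with hσs | hσs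
      · exact absurd (le_csSup hbdd ⟨hsF, hσ_pos.trans hσs, hlt⟩) (not_le.2 hσs)
      · obtain ⟨δ, hδ, hballs⟩ := Metric.isOpen_iff.1 hΦo s hsF
        set s' : ℝ := min (s + δ / 2) ((s + τ) / 2) with hs'def
        have hss' : s < s' := lt_min (by linarith) (by linarith)
        have hs'τ : s' < τ := (min_le_right _ _).trans_lt (by linarith)
        have hs'Φ : s' ∈ Φ := hballs (by
          rw [mem_ball, Real.dist_eq, abs_of_pos (by linarith)]
          linarith [min_le_left (s + δ / 2) ((s + τ) / 2)])
        have hle : s' ≤ σ := le_csSup hbdd ⟨hs'Φ, (hσ_pos.trans_le hs.1).trans hss', hs'τ⟩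
        linarith
    · exact hsF (heq ▸ hbτ)
  -- free parameters `s n → σ` and the `D'`-parameters `u n` of the free points
  obtain ⟨s, -, hsconv, hsmem⟩ := exists_seq_tendsto_sSup hne hbdd
  have hsfr : ∀ n, D.boundary (s n) ∈ frontier D'.carrier := fun n ↦
    JordanDomain.mem_frontier_of_notMem_closure_diff hsub (D.boundary_mem_frontier _) (hsmem n).1
  have hu : ∀ n, ∃ u ∈ Ico (0 : ℝ) 1, D'.boundary u = D.boundary (s n) := fun n ↦ by
    have := hsfr n
    rw [D'.frontier_eq_image_Ico] at this
    exact this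
  choose u hu huq using hu
  -- the stopping sets
  set A : ℕ → Set ℂ := fun n ↦ D.boundary '' Icc (s n) τ with hAdef
  set A' : ℕ → Set ℂ := fun n ↦ D'.boundary '' Icc (min (u n) τ') (max (u n) τ') with hA'def
  set S : ℕ → Set ℂ := fun n ↦ F ∪ A n ∪ A' n with hSdef
  have hAc : ∀ n, IsClosed (A n) := fun n ↦ (isCompact_Icc.image D.continuous_boundary).isClosed
  have hA'c : ∀ n, IsClosed (A' n) := fun n ↦ (isCompact_Icc.image D'.continuous_boundary).isClosed
  have hSc : ∀ n, IsClosed (S n) := fun n ↦ (hF.union (hAc n)).union (hA'c n)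
  have hFS : ∀ n, F ⊆ S n := fun n ↦ subset_union_left.trans subset_union_left
  -- the identity for every `n`
  have hall : ∀ n : ℕ, ∀ T : Set (CurveClass ℂ), MeasurableSet T →
      μ' (CurveClass.stopAt (S n) ⁻¹' T) = μ (CurveClass.stopAt (S n) ⁻¹' T) := fun n T hT ↦
    hμ.measure_preimage_stopAt_eq_of_free hB hD hD' hμ' hsub h0 h1 ha (hsmem n).2 (hsmem n).1
      (hu n) (huq n) (hSc n) (hFS n) (subset_union_right.trans subset_union_left)
      subset_union_right hT
  -- the stopping sets shrink to `F`
  have hlim : ∀ φ : ℕ → ℕ, Tendsto φ atTop atTop → ∀ z : ℕ → ℂ, (∀ k, z k ∈ S (φ k)) →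
      ∀ x : ℂ, Tendsto z atTop (𝓝 x) → x ∈ F := by
    intro φ hφ z hz x hx
    by_contra hxF
    have hev : ∀ᶠ k in atTop, z k ∈ A (φ k) ∨ z k ∈ A' (φ k) := by
      filter_upwards [hx (hF.isOpen_compl.mem_nhds hxF)] with k hk
      rcases hz k with (h | h) | h
      · exact absurd h hk
      · exact Or.inl h
      · exact Or.inr h
    rcases frequently_or_distrib.1 hev.frequently with hfr | hfr
    · -- points of the `∂D`-arcs accumulate on `∂D[σ, τ] ⊆ F`
      obtain ⟨ψ, hψ, hmem⟩ := extraction_of_frequently_atTop hfr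
      choose r hr hrz using hmem
      have hr01 : ∀ k, r k ∈ Icc (0 : ℝ) 1 := fun k ↦
        ⟨(hsmem _).2.1.le.trans (hr k).1, (hr k).2.trans hτ.2.le⟩
      obtain ⟨rStar, -, χ, hχ, hrconv⟩ := isCompact_Icc.tendsto_subseq hr01
      have hx1 : Tendsto (fun k ↦ D.boundary (r (χ k))) atTop (𝓝 (D.boundary rStar)) :=
        (D.continuous_boundary.tendsto _).comp hrconv
      have hx2 : Tendsto (fun k ↦ D.boundary (r (χ k))) atTop (𝓝 x) := by
        have : (fun k ↦ D.boundary (r (χ k))) = z ∘ ψ ∘ χ := funext fun k ↦ hrz (χ k)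
        rw [this]
        exact hx.comp ((hψ.comp hχ).tendsto_atTop)
      have hxeq : x = D.boundary rStar := tendsto_nhds_unique hx2 hx1
      have hσr : σ ≤ rStar :=
        le_of_tendsto_of_tendsto (hsconv.comp (hφ.comp ((hψ.comp hχ).tendsto_atTop))) hrconv
          (Eventually.of_forall fun k ↦ (hr (χ k)).1)
      have hrτ : rStar ≤ τ := le_of_tendsto' hrconv fun k ↦ (hr (χ k)).2
      exact hxF (hxeq ▸ hburied rStar ⟨hσr, hrτ⟩)
    · -- points of the `∂D'`-arcs accumulate on the `∂D'`-arc from `e` to `b`, buried as well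
      obtain ⟨ψ, hψ, hmem⟩ := extraction_of_frequently_atTop hfr
      choose r hr hrz using hmem
      have hτ'0 : 0 < τ' := by
        have := D'.strictMono_mark (show (0 : Fin 2) < 1 by decide)
        rwa [hD'] at this
      have hr01 : ∀ k, r k ∈ Icc (0 : ℝ) 1 := fun k ↦
        ⟨(le_min (hu _).1 hτ'0.le).trans (hr k).1, (hr k).2.trans (max_le (hu _).2.le hτ'.2.le)⟩
      have hp : ∀ k, (r k, u (φ (ψ k))) ∈ Icc (0 : ℝ) 1 ×ˢ Icc (0 : ℝ) 1 := fun k ↦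
        ⟨hr01 k, (hu _).1, (hu _).2.le⟩
      obtain ⟨⟨rStar, uStar⟩, ⟨-, huStar⟩, χ, hχ, hconv⟩ :=
        (isCompact_Icc.prod isCompact_Icc).tendsto_subseq hp
      have hrconv : Tendsto (fun k ↦ r (χ k)) atTop (𝓝 rStar) :=
        (continuous_fst.tendsto _).comp hconv
      have huconv : Tendsto (fun k ↦ u (φ (ψ (χ k)))) atTop (𝓝 uStar) :=
        (continuous_snd.tendsto _).comp hconv
      -- `x = D'.boundary rStar`
      have hx1 : Tendsto (fun k ↦ D'.boundary (r (χ k))) atTop (𝓝 (D'.boundary rStar)) :=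
        (D'.continuous_boundary.tendsto _).comp hrconv
      have hx2 : Tendsto (fun k ↦ D'.boundary (r (χ k))) atTop (𝓝 x) := by
        have : (fun k ↦ D'.boundary (r (χ k))) = z ∘ ψ ∘ χ := funext fun k ↦ hrz (χ k)
        rw [this]
        exact hx.comp ((hψ.comp hχ).tendsto_atTop)
      have hxeq : x = D'.boundary rStar := tendsto_nhds_unique hx2 hx1
      -- `D'.boundary uStar = e := D.boundary σ`
      have he1 : Tendsto (fun k ↦ D'.boundary (u (φ (ψ (χ k))))) atTop (𝓝 (D'.boundary uStar)) :=
        (D'.continuous_boundary.tendsto _).comp huconv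
      have he2 : Tendsto (fun k ↦ D'.boundary (u (φ (ψ (χ k))))) atTop (𝓝 (D.boundary σ)) := by
        have : (fun k ↦ D'.boundary (u (φ (ψ (χ k))))) = fun k ↦ D.boundary (s (φ (ψ (χ k)))) :=
          funext fun k ↦ huq _
        rw [this]
        exact (D.continuous_boundary.tendsto _).comp
          (hsconv.comp (hφ.comp ((hψ.comp hχ).tendsto_atTop)))
      have he : D'.boundary uStar = D.boundary σ := tendsto_nhds_unique he1 he2
      have heF : D.boundary σ ∈ F := hburied σ ⟨le_rfl, hσ_le⟩
      have huStar01 : uStar ∈ Ioo (0 : ℝ) 1 := by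
        refine ⟨lt_of_le_of_ne huStar.1 ?_, lt_of_le_of_ne huStar.2 ?_⟩
        · rintro h
          rw [← h, ha0'] at he
          exact ha0 (he ▸ heF)
        · rintro h
          rw [h, D'.periodic_boundary.eq, ha0'] at he
          exact ha0 (he ▸ heF)
      -- `rStar` lies on the arc between `uStar` and `τ'`
      have hrmem : rStar ∈ uIcc uStar τ' := by
        refine ⟨le_of_tendsto_of_tendsto (huconv.min tendsto_const_nhds) hrconv
            (Eventually.of_forall fun k ↦ (hr (χ k)).1),
          le_of_tendsto_of_tendsto hrconv (huconv.max tendsto_const_nhds)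
            (Eventually.of_forall fun k ↦ (hr (χ k)).2)⟩
      exact hxF (hxeq ▸ MarkedDomain.boundary_mem_closure_diff_of_mem_uIcc hD hD' hsub h0 h1 ha
        hσ_pos hσ_le hburied huStar01 he hrmem)
  exact measure_preimage_stopAt_eq_of_shrinking hF hSc hFS hlim hall hT

/-! ### The assembly -/

/-- **The restriction form of the locality of chordal SLE₆ follows from its bounded clause**
([LSW 2001] Thm. 2.2 / Cor. 2.4 for all nested Dobrushin domains with common marked points,
from the clause for hull subdomains): degenerate cases by
`IsSLELaw.locality_six_of_nondegenerate`; `b ∉ closure (D ∖ D')` is a hull pair; the buried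
target `b ∈ closure (D ∖ D')` by `IsSLELaw.locality_clause_of_pt_one_mem_of_rebased` after
re-basing both loops at `a`. [cite: LawlerSchrammWerner2001, Thm 2.2 and Cor 2.4] -/
theorem IsSLELaw.locality_six_of_bounded : IsSLELaw.locality_six_bounded → IsSLELaw.locality_six := by
  intro hB
  refine IsSLELaw.locality_six_of_nondegenerate fun D D' μ μ' hμ hμ' hsub _ h0 h1 ha T hT ↦ ?_
  by_cases hb : D.pt 1 ∈ closure (D.carrier \ D'.carrier)
  · obtain ⟨D₀, hc, hm, hp0, hp1⟩ := MarkedDomain.exists_rebase D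
    obtain ⟨D₀', hc', hm', hp0', hp1'⟩ := MarkedDomain.exists_rebase D'
    have hμ₀ : IsSLELaw 6 D₀ μ := hμ.of_carrier_eq hc hp0 hp1
    have hμ₀' : IsSLELaw 6 D₀' μ' := hμ'.of_carrier_eq hc' hp0' hp1'
    have key := IsSLELaw.locality_clause_of_pt_one_mem_of_rebased hB hm hm' hμ₀ hμ₀'
      (by rw [hc, hc']; exact hsub) (by rw [hp0', hp0, h0]) (by rw [hp1', hp1, h1])
      (by rw [hc, hc', hp0]; exact ha) (by rw [hc, hc', hp1]; exact hb) hT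
    rwa [hc, hc'] at key
  · exact hB D D' hμ hμ' ⟨hsub, h0, h1, ha, hb⟩ T hT

end Literature.Probability.RandomPlanarGeometry

end
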